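import Mathlib
import Literature.Computability.AlgebraicComplexity.SchoenhageTau
import Literature.Computability.AlgebraicComplexity.BorderRankRestriction
import Literature.Computability.AlgebraicComplexity.StrassenMinimalBorderRank
import Literature.Computability.AlgebraicComplexity.BorderApolarityLimits
import Literature.Computability.AlgebraicComplexity.TensorApolarityForms
import Literature.Computability.AlgebraicComplexity.BorderApolarityWeak

/-!
# Weak border apolarity from the border rank: generic perturbation of a decomposition
# (Conner–Harper–Landsberg 2023, §2.3), and symmetric versus alternating arrays

Topic `Literature/Computability/AlgebraicComplexity`. Theorems only; second half of
`BorderApolarityWeak.lean`.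

* `TensorApolarity.IsApproxDecomposition.perturb`, `TensorApolarity.det_pt_perturb_ne_zero` — an
  order-`h` approximate decomposition over `K[ε]` stays one when its `κ`- and `μ`-vectors are moved
  by `ε^M e_{x_ρ}`, `ε^M e_{y_ρ}` (`M > h`), and for `r` distinct pairs `(x_ρ, y_ρ)` and `M` beyond
  all degrees the `r × r` minors of the `(2,1,0)` and `(1,2,0)` point matrices at the columns
  `(x_ρ,x_ρ,y_ρ)`, `(x_ρ,y_ρ,y_ρ)` are `≡ ε^{3M} · 1` modulo lower degree, hence non-zero
  (`det_ne_zero_of_degree_lt`): "For all `(ijk)` with `i+j+k>1`, we may choose the curves such that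
  `codim(I_{ijk}) = r`" (CHL §2.3), in the two bi-degrees used.
* `TensorApolarity.exists_subspace_of_algBorderRank_le` — **weak border apolarity in bi-degrees
  `(110)`, `(210)`, `(120)`**: if `bR(t) ≤ r` and `r ≤ |κ||μ|` (an injection `Fin r ↪ κ × μ`), some
  `F ⊆ t(C*)^⊥` has `dim F ≥ |κ||μ| − r`, `dim(F·A* + Alt) ≤ |κ|²|μ| − r`,
  `dim(F·B* + Alt) ≤ |κ||μ|² − r` (CHL §2.3 (i)–(iii) without the Borel-fixedness (iv)).
* `TensorApolarity.prodA_inf_altA_eq_bot`, `…prodB…` — products are symmetric arrays, so in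
  characteristic `0` they meet the alternating arrays trivially (used to read the bounds above as
  `dim(F·A*) + dim Alt ≤ …`).

## References

* A. Conner, A. Harper, J. M. Landsberg, *New lower bounds for matrix multiplication and `det₃`*,
  Forum Math. Pi 11 (2023) e17, arXiv:1911.07981: §2.3. [ConnerHarperLandsberg2023]
* M. Bläser, *Fast Matrix Multiplication*, Theory of Computing Graduate Surveys 5 (2013), Def. 6.1. [Blaser2013]
-/

noncomputable section

open Polynomial Module
open scoped Polynomial BigOperators

namespace Literature.Computability.AlgebraicComplexity

namespace TensorApolarity

universe u

variable {K : Type u} [Field K]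
variable {ι κ μ : Type} [Fintype ι] [Fintype κ] [Fintype μ] [DecidableEq ι] [DecidableEq κ]
  [DecidableEq μ]

/-! ## Generic perturbation of a decomposition -/

section Perturb

variable {r : ℕ}

omit [Fintype ι] [Fintype κ] [Fintype μ] [DecidableEq ι] in
/-- A perturbation of order `ε^M`, `M > h`, of an order-`h` approximate decomposition is again one.
[cite: ConnerHarperLandsberg2023, §2.3] -/
theorem IsApproxDecomposition.perturb {h : ℕ} {t : ι → κ → μ → K} {u : Fin r → ι → K[X]}
    {v : Fin r → κ → K[X]} {w : Fin r → μ → K[X]} (hd : IsApproxDecomposition h t u v w) {M : ℕ}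
    (hM : h < M) (xs : Fin r → κ) (ys : Fin r → μ) :
    IsApproxDecomposition h t u (perturbV M xs v) (perturbW M ys w) := by
  intro a b c j hj
  have key : ∀ ρ, u ρ a * perturbV M xs v ρ b * perturbW M ys w ρ c =
      u ρ a * v ρ b * w ρ c + X ^ M * (u ρ a * ((Pi.single (xs ρ) (1 : K[X]) : κ → K[X]) b * w ρ c +
        v ρ b * (Pi.single (ys ρ) (1 : K[X]) : μ → K[X]) c +
        X ^ M * ((Pi.single (xs ρ) (1 : K[X]) : κ → K[X]) b *
          (Pi.single (ys ρ) (1 : K[X]) : μ → K[X]) c))) := by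
    intro ρ
    rw [perturbV_apply, perturbW_apply]
    ring
  have hlt : ¬ M ≤ j := by omega
  simp only [key, Finset.sum_add_distrib, ← Finset.mul_sum, Polynomial.coeff_add,
    Polynomial.coeff_X_pow_mul', if_neg hlt, add_zero]
  exact hd a b c j hj

omit [Fintype ι] [DecidableEq ι] [Fintype κ] [Fintype μ] [DecidableEq κ] [DecidableEq μ] in
/-- A polynomial `p + X^M c`, `deg p < M`, `c ∈ {0,1}`, has degree `≤ M` and `M`-th coefficient
`c`. [folklore] -/
theorem natDegree_add_X_pow_mul_le {p : K[X]} {M : ℕ} (hp : p.natDegree < M) (c : K[X])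
    (hc : c = 0 ∨ c = 1) :
    (p + X ^ M * c).natDegree ≤ M ∧ (p + X ^ M * c).coeff M = c.coeff 0 := by
  rcases hc with rfl | rfl
  · simp only [mul_zero, add_zero, coeff_zero]
    exact ⟨hp.le, Polynomial.coeff_eq_zero_of_natDegree_lt hp⟩
  · constructor
    · refine (Polynomial.natDegree_add_le _ _).trans (max_le hp.le ?_)
      simp
    · rw [Polynomial.coeff_add, Polynomial.coeff_eq_zero_of_natDegree_lt hp, mul_one,
        Polynomial.coeff_X_pow_self]
      simp

omit [Fintype ι] [DecidableEq ι] [Fintype κ] [Fintype μ] [DecidableEq κ] [DecidableEq μ] in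
/-- Degree and top coefficient of a triple product of polynomials of degree `≤ M`. [folklore] -/
theorem coeff_mul_mul_of_natDegree_le {p q s : K[X]} {M : ℕ} (hp : p.natDegree ≤ M)
    (hq : q.natDegree ≤ M) (hs : s.natDegree ≤ M) :
    (p * q * s).natDegree ≤ 3 * M ∧ (p * q * s).coeff (3 * M) = p.coeff M * q.coeff M * s.coeff M := by
  have hpq : (p * q).natDegree ≤ M + M := Polynomial.natDegree_mul_le_of_le hp hq
  constructor
  · have := Polynomial.natDegree_mul_le_of_le hpq hs
    omega
  · have e : 3 * M = (M + M) + M := by ring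
    rw [e, Polynomial.coeff_mul_add_eq_of_natDegree_le hpq hs,
      Polynomial.coeff_mul_add_eq_of_natDegree_le hp hq]

omit [Fintype ι] [DecidableEq ι] [Fintype κ] [Fintype μ] [DecidableEq κ] [DecidableEq μ] in
/-- A coordinate vector has entries `0` or `1`. [folklore] -/
theorem single_eq_zero_or_one {α : Type} [DecidableEq α] (x k : α) :
    (Pi.single x (1 : K[X]) : α → K[X]) k = 0 ∨ (Pi.single x (1 : K[X]) : α → K[X]) k = 1 := by
  by_cases hk : k = x
  · subst hk; simp
  · left; simp [hk]

omit [Fintype ι] [DecidableEq ι] [Fintype κ] [Fintype μ] [DecidableEq κ] [DecidableEq μ] in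
/-- A polynomial of degree `≤ N` with vanishing `N`-th coefficient has degree `< N`. [folklore] -/
theorem degree_lt_of_natDegree_le_of_coeff_eq_zero {p : K[X]} {N : ℕ} (h1 : p.natDegree ≤ N)
    (h2 : p.coeff N = 0) : p.degree < (N : WithBot ℕ) := by
  rw [Polynomial.degree_lt_iff_coeff_zero]
  intro m hm
  rcases hm.lt_or_eq with h | h
  · exact Polynomial.coeff_eq_zero_of_natDegree_lt (h1.trans_lt h)
  · exact h ▸ h2

/-- **Generic perturbation.** Given `r` distinct index pairs `(x_ρ, y_ρ) ∈ κ × μ`, the perturbed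
decomposition `v'_ρ = v_ρ + ε^M e_{x_ρ}`, `w'_ρ = w_ρ + ε^M e_{y_ρ}` (`M` beyond all degrees) has
non-vanishing `r × r` minors of its `(2,1,0)` and `(1,2,0)` point matrices at the columns
`(x_ρ, x_ρ, y_ρ)`, `(x_ρ, y_ρ, y_ρ)`: these minors are `≡ ε^{3M} · 1` modulo lower degree.
[cite: ConnerHarperLandsberg2023, §2.3] -/
theorem det_pt_perturb_ne_zero (v : Fin r → κ → K[X]) (w : Fin r → μ → K[X]) (e : Fin r ↪ κ × μ)
    {M : ℕ} (hM : degBound v w < M) :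
    (Matrix.of fun ρ ρ' : Fin r => pt₂ (perturbV M (fun ρ => (e ρ).1) v)
        (perturbW M (fun ρ => (e ρ).2) w) ρ ((e ρ').1, ((e ρ').1, (e ρ').2))).det ≠ 0 ∧
    (Matrix.of fun ρ ρ' : Fin r => pt₃ (perturbV M (fun ρ => (e ρ).1) v)
        (perturbW M (fun ρ => (e ρ).2) w) ρ ((e ρ').1, ((e ρ').2, (e ρ').2))).det ≠ 0 := by
  set v' := perturbV M (fun ρ => (e ρ).1) v with hv'
  set w' := perturbW M (fun ρ => (e ρ).2) w with hw'
  -- degrees and top coefficients of the perturbed coordinates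
  have hv : ∀ ρ k, (v' ρ k).natDegree ≤ M ∧
      (v' ρ k).coeff M = (Pi.single (e ρ).1 (1 : K) : κ → K) k := by
    intro ρ k
    rw [hv', perturbV_apply]
    have h := natDegree_add_X_pow_mul_le ((natDegree_v_le_degBound v w ρ k).trans_lt hM)
      ((Pi.single (e ρ).1 (1 : K[X]) : κ → K[X]) k) (single_eq_zero_or_one _ _)
    refine ⟨h.1, h.2.trans ?_⟩
    by_cases hk : k = (e ρ).1
    · subst hk; simp
    · simp [hk]
  have hw : ∀ ρ m, (w' ρ m).natDegree ≤ M ∧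
      (w' ρ m).coeff M = (Pi.single (e ρ).2 (1 : K) : μ → K) m := by
    intro ρ m
    rw [hw', perturbW_apply]
    have h := natDegree_add_X_pow_mul_le ((natDegree_w_le_degBound v w ρ m).trans_lt hM)
      ((Pi.single (e ρ).2 (1 : K[X]) : μ → K[X]) m) (single_eq_zero_or_one _ _)
    refine ⟨h.1, h.2.trans ?_⟩
    by_cases hm : m = (e ρ).2
    · subst hm; simp
    · simp [hm]
  -- the top coefficient matrix is the identity
  have hone : ∀ ρ ρ' : Fin r,
      (Pi.single (e ρ).1 (1 : K) : κ → K) (e ρ').1 * (Pi.single (e ρ).1 (1 : K) : κ → K) (e ρ').1 *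
        (Pi.single (e ρ).2 (1 : K) : μ → K) (e ρ').2 = (1 : Matrix (Fin r) (Fin r) K) ρ ρ' ∧
      (Pi.single (e ρ).1 (1 : K) : κ → K) (e ρ').1 * (Pi.single (e ρ).2 (1 : K) : μ → K) (e ρ').2 *
        (Pi.single (e ρ).2 (1 : K) : μ → K) (e ρ').2 = (1 : Matrix (Fin r) (Fin r) K) ρ ρ' := by
    intro ρ ρ'
    by_cases hρ : ρ = ρ'
    · subst hρ; simp
    · have hne : e ρ' ≠ e ρ := fun h => hρ (e.injective h).symm
      rw [Matrix.one_apply_ne hρ]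
      by_cases h1 : (e ρ').1 = (e ρ).1
      · have h2 : (e ρ').2 ≠ (e ρ).2 := fun h2 => hne (Prod.ext h1 h2)
        simp [Pi.single_apply, h2]
      · simp [Pi.single_apply, h1]
  -- a matrix with entries of degree `≤ 3M` and top coefficients `δ` is `≡ ε^{3M}·1`
  have key : ∀ (Q : Matrix (Fin r) (Fin r) K[X]), (∀ ρ ρ', (Q ρ ρ').natDegree ≤ 3 * M) →
      (∀ ρ ρ', (Q ρ ρ').coeff (3 * M) = (1 : Matrix (Fin r) (Fin r) K) ρ ρ') → Q.det ≠ 0 := by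
    intro Q hdeg hcoef
    refine det_ne_zero_of_degree_lt (3 * M) Q (fun i => ?_) (fun i j hij => ?_)
    · refine degree_lt_of_natDegree_le_of_coeff_eq_zero
        ((Polynomial.natDegree_sub_le _ _).trans (max_le (hdeg i i) (by simp))) ?_
      rw [Polynomial.coeff_sub, hcoef, Polynomial.coeff_X_pow_self, Matrix.one_apply_eq, sub_self]
    · refine degree_lt_of_natDegree_le_of_coeff_eq_zero (hdeg i j) ?_
      rw [hcoef, Matrix.one_apply_ne hij]
  constructor
  · refine key _ (fun ρ ρ' => ?_) (fun ρ ρ' => ?_)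
    · exact (coeff_mul_mul_of_natDegree_le (hv ρ _).1 (hv ρ _).1 (hw ρ _).1).1
    · have hv2 : ∀ k, (v' ρ k).coeff M = (Pi.single (e ρ).1 (1 : K) : κ → K) k := fun k => (hv ρ k).2
      have hw2 : ∀ m, (w' ρ m).coeff M = (Pi.single (e ρ).2 (1 : K) : μ → K) m := fun m => (hw ρ m).2
      rw [Matrix.of_apply]
      simp only [pt₂]
      rw [(coeff_mul_mul_of_natDegree_le (hv ρ _).1 (hv ρ _).1 (hw ρ _).1).2, hv2, hw2]
      exact (hone ρ ρ').1
  · refine key _ (fun ρ ρ' => ?_) (fun ρ ρ' => ?_)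
    · exact (coeff_mul_mul_of_natDegree_le (hv ρ _).1 (hw ρ _).1 (hw ρ _).1).1
    · have hv2 : ∀ k, (v' ρ k).coeff M = (Pi.single (e ρ).1 (1 : K) : κ → K) k := fun k => (hv ρ k).2
      have hw2 : ∀ m, (w' ρ m).coeff M = (Pi.single (e ρ).2 (1 : K) : μ → K) m := fun m => (hw ρ m).2
      rw [Matrix.of_apply]
      simp only [pt₃]
      rw [(coeff_mul_mul_of_natDegree_le (hv ρ _).1 (hw ρ _).1 (hw ρ _).1).2, hv2, hw2]
      exact (hone ρ ρ').2

end Perturb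

/-! ## Weak border apolarity from the border rank -/

omit [DecidableEq ι] in
/-- **Weak border apolarity in bi-degrees `(110)`, `(210)`, `(120)`.** If `bR(t) ≤ r ≤ |κ|·|μ|`
(algebraic border rank over `K[ε]`), there is a subspace `F` of bilinear forms on `A × B` with
`F ⊆ t(C^*)^⊥`, `dim F ≥ |κ||μ| - r`, `dim(F·A^* + Alt) ≤ |κ|²|μ| - r` and
`dim(F·B^* + Alt) ≤ |κ||μ|² - r` — the necessary conditions (i)–(iii) of CHL 2023 §2.3 in these
bi-degrees, i.e. the input of the `(210)` and `(120)` tests of §3, without the Borel-fixedness (iv).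
[cite: ConnerHarperLandsberg2023, §2.3 (i)–(iii), §3 (i)] -/
theorem exists_subspace_of_algBorderRank_le (t : ι → κ → μ → K) {r : ℕ}
    (hr : algBorderRank t ≤ r) (e : Fin r ↪ κ × μ) :
    ∃ F : Submodule K (κ × μ → K), F ≤ slicePerp t ∧
      Fintype.card κ * Fintype.card μ - r ≤ finrank K F ∧
      finrank K ↥(prodA F ⊔ altA K κ μ) ≤ Fintype.card κ * (Fintype.card κ * Fintype.card μ) - r ∧
      finrank K ↥(prodB F ⊔ altB K κ μ) ≤ Fintype.card κ * (Fintype.card μ * Fintype.card μ) - r := by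
  classical
  -- an order-`h` approximate decomposition with exactly `r` triads
  obtain ⟨h, hh⟩ := exists_algBorderRank_eq_approxRank t
  have hhr : approxRank h t ≤ r := hh ▸ hr
  obtain ⟨u, v, w, hd⟩ := exists_isApproxDecomposition_of_approxRank_le hhr
  -- perturb it generically
  set M := max h (degBound v w) + 1 with hMdef
  have hM₁ : h < M := by omega
  have hM₂ : degBound v w < M := by omega
  have hd' := IsApproxDecomposition.perturb hd hM₁ (fun ρ => (e ρ).1) (fun ρ => (e ρ).2)
  obtain ⟨h₂, h₃⟩ := det_pt_perturb_ne_zero v w e hM₂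
  exact weak_apolarity_of_decomposition hd' _ h₂ _ h₃


/-! ## Symmetric products meet the alternating arrays trivially -/

omit [Fintype ι] [DecidableEq ι] [Fintype κ] [Fintype μ] [DecidableEq μ] in
/-- `F·A* ∩ Alt = 0` in characteristic `0` (products are symmetric arrays). [folklore] -/
theorem prodA_inf_altA_eq_bot [CharZero K] (F : Submodule K (κ × μ → K)) :
    prodA F ⊓ altA K κ μ = ⊥ := by
  -- the symmetric arrays
  let W : Submodule K (κ × (κ × μ) → K) :=
    { carrier := {g | ∀ k k' m, g (k, (k', m)) = g (k', (k, m))}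
      add_mem' := fun hg hg' k k' m => by simp [hg k k' m, hg' k k' m]
      zero_mem' := fun _ _ _ => rfl
      smul_mem' := fun c g hg k k' m => by simp [hg k k' m] }
  have hW : prodA F ≤ W := by
    refine prodA_le_iff.2 fun f _ x k k' m => ?_
    simp only [mulA_apply]
    ring
  rw [eq_bot_iff]
  rintro g ⟨hg, hga⟩
  rw [Submodule.mem_bot]
  funext ⟨k, k', m⟩
  have h1 := hW hg k k' m
  have h2 := hga.1 k k' m
  rw [h1] at h2
  have : g (k', (k, m)) = 0 := self_eq_neg.1 h2
  rw [Pi.zero_apply, h1, this]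

omit [Fintype ι] [DecidableEq ι] [Fintype κ] [Fintype μ] [DecidableEq κ] in
/-- `F·B* ∩ Alt = 0` in characteristic `0`. [folklore] -/
theorem prodB_inf_altB_eq_bot [CharZero K] (F : Submodule K (κ × μ → K)) :
    prodB F ⊓ altB K κ μ = ⊥ := by
  let W : Submodule K (κ × (μ × μ) → K) :=
    { carrier := {g | ∀ k m m', g (k, (m, m')) = g (k, (m', m))}
      add_mem' := fun hg hg' k m m' => by simp [hg k m m', hg' k m m']
      zero_mem' := fun _ _ _ => rfl
      smul_mem' := fun c g hg k m m' => by simp [hg k m m'] }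
  have hW : prodB F ≤ W := by
    refine prodB_le_iff.2 fun f _ y k m m' => ?_
    simp only [mulB_apply]
    ring
  rw [eq_bot_iff]
  rintro g ⟨hg, hga⟩
  rw [Submodule.mem_bot]
  funext ⟨k, m, m'⟩
  have h1 := hW hg k m m'
  have h2 := hga.1 k m m'
  rw [h1] at h2
  have : g (k, (m', m)) = 0 := self_eq_neg.1 h2
  rw [Pi.zero_apply, h1, this]

end TensorApolarity

end Literature.Computability.AlgebraicComplexity

end
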